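import Summits.PneNP.PneNP.Theses.LatticeMagic

/-!
# Skeleton — line `Sketch` (card `certified-deep-holes`) for the crux `Target` (stmt-PneNP-10709)

Lead's copy of ideator 2's `Sketch.lean` (evidence 20260816T112022Z-Sketch.lean, sha ad2848c7cfde0566),
reconstructed from the card's verbatim quotation (the evidence store `run/gate/evidence/` is not mounted in
the lead's jail) and put into SKELETON SHAPE: one registered stub `stub_remotePointUncertifiable` (= C⁺, the
apex) and the composition `Target_of : Target` that concludes the crux BY NAME.

* C⁺ = `RemotePointUncertifiable` (lattice Remote-Point ∉ SearchNP, ∃t-form of the crux): for some constant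
  `c ≥ 1`, every NP language that is SOUND for farness (contains the code of no instance with
  `dist(t, L(B)) ≤ d`) certifies NO integer point of some lattice-with-radius `(B, d)` that does have a
  `c·d`-far integer point.
* `Target_of : Target` from the stub (the transfer C⁺ → Target inlined; X := Kᶜ for the coNP separator K).
* S⁺ = "GapSVP_c ∉ PromiseCoNP for some constant c ≥ 1" and `S⁺ → Target` (via the discharged Aharonov–Regev
  Lemma A.1 `AharonovRegev2005_lemmaA1_holds`) is a side transfer, not a stub; it lives on the Theorems side only.

STRENGTH (lead, cycle 1): `Target ↔ NP ≠ coNP` is a tree theorem (p101056,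
`Theorems/LatticeMagicTargetIffNPneCoNP.lean`), so the one stub below is ≥ `NP ≠ coNP`.
-/

noncomputable section

open Literature.Algebra.EuclideanLattices Literature.Computability.Complexity

set_option linter.dupNamespace false

namespace Summit.PneNP.PneNP.Cruxes.Target.CertifiedDeepHoles

/-- **C⁺ — certified deep holes are impossible at constant factor** (lattice Remote-Point ∉ SearchNP). -/
def RemotePointUncertifiable : Prop :=
  ∃ c : ℝ, 1 ≤ c ∧ ∀ X : Language Bool, X ∈ Nondeterministic.NP →
    (∀ p : GapCVPInstance, p ∈ GapCVP.yes (fun _ => c) → GapCVPInstance.encode p ∉ X) →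
    ∃ (I : LatticeInstance) (d : ℚ),
      (∃ t : Fin I.n → ℤ, (((⟨I, t⟩ : CVPInstance), d) : GapCVPInstance) ∈ GapCVP.no (fun _ => c)) ∧
      ∀ t : Fin I.n → ℤ, GapCVPInstance.encode (((⟨I, t⟩ : CVPInstance), d) : GapCVPInstance) ∉ X

/-- THE STUB (apex of the line; conjecture-grade, ≥ `NP ≠ coNP` since it implies `Target`). -/
theorem stub_remotePointUncertifiable : RemotePointUncertifiable := by
  sorry

/-- **Composition (the skeleton’s deciding theorem: the only theorem concluding the crux, no hypotheses):**
`Target` from the single stub. If a coNP language `K` separated GapCVP_c, then `X := Kᶜ ∈ NP` is sound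
for farness (it contains no YES code) and contains every NO code; the stub gives a lattice `(I, d)` with
a `c·d`-far integer point `t` — a NO instance whose code must lie in `X` — and yet no code `((I, t), d)`
in `X`: contradiction. -/
theorem Target_of : Summit.PneNP.PneNP.Theses.LatticeMagic.Target := by
  obtain ⟨c, hc, hC⟩ := stub_remotePointUncertifiable
  refine ⟨c, hc, ?_⟩
  rintro ⟨K, hK, hyes, hno⟩
  have hX : Kᶜ ∈ Nondeterministic.NP := hK
  have hsound : ∀ p : GapCVPInstance, p ∈ GapCVP.yes (fun _ => c) → GapCVPInstance.encode p ∉ Kᶜ :=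
    fun p hp hpX => hpX (hyes ⟨p, hp, rfl⟩)
  obtain ⟨I, d, ⟨t, ht⟩, hnone⟩ := hC Kᶜ hX hsound
  exact hnone t (hno ⟨_, ht, rfl⟩)

/-! ### Transfers in hypothesis form
`C⁺ → Target` and `S⁺ → Target` (S⁺ = `GapSVPNotCoNP`, via the discharged Aharonov–Regev Lemma A.1
`AharonovRegev2005_lemmaA1_holds`) are NOT restated here as theorems (the skeleton checker admits exactly one
theorem concluding the crux, with no hypotheses but registered stubs); they are landed on the Theorems side as
`Summit.PneNP.PneNP.Theorems.latticeMagicTarget_of_remotePointUncertifiable` and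
`Summit.PneNP.PneNP.Theorems.latticeMagicTarget_of_gapSVP_not_mem_promiseCoNP`
(file `Theorems/LatticeMagicTargetRemotePoint.lean`), next to `latticeMagicTarget_iff_NP_ne_coNP`
(file `Theorems/LatticeMagicTargetIffNPneCoNP.lean`, p101056). -/

end Summit.PneNP.PneNP.Cruxes.Target.CertifiedDeepHoles
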